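import Summits.CriticalPhenomena.CardyFormulaZ2.Theorems.CardySelfRefinementLagHandOffKernelFlatDictionary
import Summits.CriticalPhenomena.CardyFormulaZ2.Theorems.CardySelfRefinementLagHandOffKernelFlatBound
import Summits.CriticalPhenomena.CardyFormulaZ2.Theorems.CardySelfRefinementLagHandOffKernelFlatLink2
import Summits.CriticalPhenomena.CardyFormulaZ2.Theorems.CardySelfRefinementLagHandOffHalfPlaneTwoArmUndocked
import HarnessLib

/-!
# The flat-boundary misdock kernel at the Dobrushin level, diameter form:
stub `stub_kernel_flatStripMisdock2` of line `hitting-tournament` for crux `LagHandOff`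
(stmt-CriticalPhenomena-10268)

The STRIP brick (diameter form, unconditional) of the flat boundary kernel of the lag hand-off
(seat c6).  Let `E` be admissible discrete Dobrushin data at mesh `E.δ`, `ω° := ω ∩ E(Ω_δ)` the
trace of a bond configuration on the edges of `Ω_δ = discreteDomainGraph E.Ω E.δ`, and `K(c)` the
set of sites joined to the non-arc site `c ∈ Ω_δ` by `ω°`-open paths inside `Ω_δ ∖ (arcs)`.
Under a FLAT piece of the wired arc (the lattice box `[j - M, j + N + M] × [b - 1, b + M]` lies
in `Ω_δ`, its row `b - 1` is exactly the discrete arc of `A` there, it carries no arc-`B` site,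
`ℤ²`-neighbours in the box are `Ω_δ`-neighbours, and `4R + H + 2δ ≤ Mδ`), the event

  "some MISDOCKED cluster `K(c)` (no `ω`-open contact edge of `Ω_δ` into the arc of `A` is
  reachable from `c`) has DIAMETER `≥ 6R` (two of its sites are at mesh distance `≥ 6R`) and has
  a LOWEST low strip site `z` (columns `[j, j + N]`, heights `(v 1 - b) δ ≤ H`) whose column is
  at distance `≥ 4R` from both ends of the strip"

has probability `≤ C ((N + 1) δ / H + 1) (H / R) ^ (1 + α)` for `H ≥ H₀ δ`, `R ≥ K H`.

Compared with the landed `stub_kernel_flatStripMisdock` (file `…KernelFlatStrip.lean`):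
(a) the flat misdock dictionary is no longer a hypothesis — it is the landed theorem
`stub_kernel_flatMisdockDictionary`; (b) the far-site conjunct of the event is in diameter form,
matching the landed pointwise link `stub_kernel_flatMisdockLink2`.

Proof = composition of landed theorems of this line:
* `stub_kernel_flatMisdockBound` (fed with `stub_kernel_flatMisdockDictionary` and the undocked
  half-plane three-arm bound `stub_noTouch_undockedThreeArm`) bounds, at mesh `δ = E.δ` and column
  count `N + 1`, the probability that some `z` with column in `[j, j + N + 1)` and height `≤ H` is
  lowest in its raw-`ω` cluster inside the half-disc `W_z` of radius `4R`, with closed legs into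
  row `b - 1`, the cluster reaching distance `3R`;
* `stub_kernel_flatMisdockLink2` (at `R' = R`) shows that every configuration `ω ⊆ E(ℤ²)` of the
  event above, with witnesses `c, z`, lies in that event at the same `z`;
* `ω ⊆ E(ℤ²)` holds almost surely (`ae_subset_edgeSet`), so `measureReal_le_of_ae_imp` and
  `((N + 1 : ℕ) : ℝ) = N + 1` finish.

References: G. F. Lawler, O. Schramm, W. Werner, Electron. J. Probab. 7 (2002), Appendix A
[LawlerSchrammWernerEJP2002]; S. Smirnov, W. Werner, Math. Res. Lett. 8 (2001), §3
[SmirnovWerner2001].  Nothing else is proved here (no geometry, no probability beyond the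
monotonicity of `Measure.real` along an a.e. inclusion).
-/

noncomputable section

open Set Metric MeasureTheory
open Literature.Probability.Percolation Literature.Probability.LatticeModels

namespace Summit.CriticalPhenomena.CardyFormulaZ2.Cruxes.LagHandOff.HittingTournament

/-- **STRIP2 `stub_kernel_flatStripMisdock2`** (registered stub of the crux `LagHandOff`, line
`hitting-tournament`; diameter form, unconditional).  There are constants `C, α > 0`,
`H₀, K ≥ 1` such that for all admissible discrete Dobrushin data `E`, every flat piece
`[j - M, j + N + M] × [b - 1, b + M]` of the wired arc with `4R + H + 2 E.δ ≤ M E.δ`,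
`H ≥ H₀ E.δ`, `R ≥ K H`: the probability that some misdocked `ω°`-cluster `K(c)` of diameter
`≥ 6R` has a lowest low strip site `z` (column in `[j, j + N]`, height `(z 1 - b) E.δ ≤ H`) at
horizontal distance `≥ 4R` from both strip ends is at most
`C ((N + 1) E.δ / H + 1) (H / R) ^ (1 + α)`.  Composition of `stub_kernel_flatMisdockBound`
(fed with `stub_kernel_flatMisdockDictionary` and `stub_noTouch_undockedThreeArm`, at mesh `E.δ`
and column count `N + 1`) with the pointwise link `stub_kernel_flatMisdockLink2` at `R' = R`,
along the almost sure inclusion `ω ⊆ E(ℤ²)`. [cite: LawlerSchrammWernerEJP2002, Appendix A] -/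
theorem stub_kernel_flatStripMisdock2 : ∃ C α : ℝ, 0 < C ∧ 0 < α ∧ ∃ H₀ K : ℝ, 1 ≤ H₀ ∧ 1 ≤ K ∧ ∀ (E : DiscreteDobrushin), E.IsZdAdmissible → ∀ (b j : ℤ) (N M : ℕ) (H R : ℝ), 1 ≤ N → H₀ * E.δ ≤ H → K * H ≤ R → (∀ v : Site 2, j - M ≤ v 0 → v 0 ≤ j + N + M → b - 1 ≤ v 1 → v 1 ≤ b + M → v ∈ meshDomain E.Ω E.δ ∧ (v ∈ E.zdArcA ↔ v 1 = b - 1) ∧ v ∉ E.zdArcB) → (∀ v w : Site 2, j - M ≤ v 0 → v 0 ≤ j + N + M → b - 1 ≤ v 1 → v 1 ≤ b + M → j - M ≤ w 0 → w 0 ≤ j + N + M → b - 1 ≤ w 1 → w 1 ≤ b + M → (zdGraph 2).Adj v w → (discreteDomainGraph E.Ω E.δ).Adj v w) → 4 * R + H + 2 * E.δ ≤ M * E.δ → (bondPercolation (zdGraph 2) half).real {ω | ∃ c z : Site 2, c ∈ meshDomain E.Ω E.δ ∧ c ∉ E.zdArcA ∪ E.zdArcB ∧ (¬ ∃ u u'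 : Site 2, u' ∈ E.zdArcA ∧ u ∉ E.zdArcA ∪ E.zdArcB ∧ s(u, u') ∈ ω ∧ s(u, u') ∈ (discreteDomainGraph E.Ω E.δ).edgeSet ∧ (ω ∩ (discreteDomainGraph E.Ω E.δ).edgeSet) ∈ openConnIn (meshDomain E.Ω E.δ \ (E.zdArcA ∪ E.zdArcB)) c u) ∧ (∃ y₁ y₂ : Site 2, (ω ∩ (discreteDomainGraph E.Ω E.δ).edgeSet) ∈ openConnIn (meshDomain E.Ω E.δ \ (E.zdArcA ∪ E.zdArcB)) c y₁ ∧ (ω ∩ (discreteDomainGraph E.Ω E.δ).edgeSet) ∈ openConnIn (meshDomain E.Ω E.δ \ (E.zdArcA ∪ E.zdArcB)) c y₂ ∧ 6 * R ≤ dist (meshPoint E.δ y₁) (meshPoint E.δ y₂)) ∧ (ω ∩ (discreteDomainGraph E.Ω E.δ).edgeSet) ∈ openConnIn (meshDomain E.Ω E.δ \ (E.zdArcA ∪ E.zdArcB)) c z ∧ j ≤ z 0 ∧ z 0 ≤ j + N ∧ b ≤ z 1 ∧ ((z 1 - b : ℤ) : ℝ) * E.δ ≤ H ∧ (∀ y :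 Site 2, (ω ∩ (discreteDomainGraph E.Ω E.δ).edgeSet) ∈ openConnIn (meshDomain E.Ω E.δ \ (E.zdArcA ∪ E.zdArcB)) c y → j ≤ y 0 → y 0 ≤ j + N → b ≤ y 1 → z 1 ≤ y 1) ∧ (j : ℝ) * E.δ + 4 * R ≤ (z 0 : ℝ) * E.δ ∧ (z 0 : ℝ) * E.δ + 4 * R ≤ ((j + N : ℤ) : ℝ) * E.δ} ≤ C * (((N : ℝ) + 1) * E.δ / H + 1) * (H / R) ^ (1 + α) := by
  obtain ⟨C, α, hC, hα, H₀, K, hH₀, hK, hB⟩ :=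
    stub_kernel_flatMisdockBound stub_kernel_flatMisdockDictionary stub_noTouch_undockedThreeArm
  refine ⟨C, α, hC, hα, H₀, K, hH₀, hK, ?_⟩
  intro E hE b j N M H R _hN hH hR hflat hadjflat hM
  -- the scales: `0 < E.δ ≤ H ≤ R`
  have hδ : 0 < E.δ := hE.delta_pos
  have hδH : E.δ ≤ H := (le_mul_of_one_le_left hδ.le hH₀).trans hH
  have hHpos : 0 < H := lt_of_lt_of_le hδ hδH
  have hHR : H ≤ R := (le_mul_of_one_le_left hHpos.le hK).trans hR
  have hRpos : 0 < R := lt_of_lt_of_le hHpos hHR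
  have hδR : E.δ ≤ R := hδH.trans hHR
  -- a.e. inclusion into the event of `stub_kernel_flatMisdockBound` at `(E.δ, b, j, N + 1, H, R)`
  refine (measureReal_le_of_ae_imp (μ := bondPercolation (zdGraph 2) half) ?_).trans
    ((hB E.δ b j (N + 1) H R hδ (by omega) hH hR).trans_eq ?_)
  · filter_upwards [ae_subset_edgeSet (zdGraph 2) half] with ω hω h
    obtain ⟨c, z, hc, hcA, hmis, hfar, hz, hjz, hzN, hbz, hzH, hlow, h4R, h4R'⟩ := h
    obtain ⟨hlow', hleg, hreach⟩ :=
      stub_kernel_flatMisdockLink2 E hE ω b j N M c H R hω hHpos.le hRpos hflat hadjflat hM hc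
        hcA hmis hfar z hz hjz hzN hbz hzH hlow R hδR le_rfl h4R h4R'
    exact ⟨z, hjz, by push_cast; omega, hbz, hzH, hlow', hleg, hreach⟩
  · push_cast
    ring

end Summit.CriticalPhenomena.CardyFormulaZ2.Cruxes.LagHandOff.HittingTournament

end
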